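import Literature.NumberTheory.EllipticCurves.FormalGroupXDerivativeProofs
import HarnessLib

/-!
# The formal group of a short Weierstrass model to order `z⁹`: `z²x(z) = 1 − a₄z⁴ − a₆z⁶ − a₄²z⁸ + O(z¹⁰)` and the
# tangent-line Kummer series `Θ` to order `z⁹`

Summit `BirchSwinnertonDyer`, route `ManinLocalTwoThree` (cell bsd-f2-manin), crux C3 `ManinPrimeToThreeAtNine` (stmt-BirchSwinnertonDyer-22968),
stubs NB₃ / (BL): infrastructure for pushing the lead's `3`-blindness certificate from `z³` (`…ThreeBlindCertificate`,
`coeff_formalXMulSq_le_three`) to `z⁹` — the level at which, numerically, EVERY non-blind `3`-torsion point is detected (lead's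
first-bad-index law, HOME/p1/BL-scan-memo-p1-g5.md: 2 808 + 972 / 3 780 local, 19 498 + 4 080 / 23 578 optimal) and at which the
conjectured congruence law (BL♯) «blind ⟹ [v₃α = 1 ∧ Y₁ ≡ 4(α/3)³ (9)] ∨ [v₃α ≥ 2 ∧ v₃Y₁ = 2]» lives.

* `formalXMulSq_sub_trunc_nine` — over ANY commutative ring, for `a₁ = a₂ = a₃ = 0`:
  `z²x(z) − (1 − a₄z⁴ − a₆z⁶ − a₄²z⁸) ∈ z¹⁰·R⟦z⟧`, by a UNIT argument on the chart equation `u² = u³ + a₄z⁴u + a₆z⁶`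
  (`formalXMulSq_sq_eq`): `(u − v)·G = −F(v)`, `F(v) = z¹⁰·Q` (explicit), `G(0) = −1`;
* `coeff_formalXMulSq_four … _nine` — the coefficients `−a₄, 0, −a₆, 0, −a₄², 0`;
* `coeff_kummerCube_generic_le_nine` — `Θ = z³y − Y z³ − α(z²x·z − X z³)` has coefficients
  `(−1, −α, 0, αX − Y, a₄, αa₄, a₆, αa₆, a₄², αa₄²)` in degrees `0 … 9`.

Nothing about BSD, Manin's conjecture or C3 is proved. [cite: SilvermanAEC2009, IV.1 (expansion of x(z) after Prop. 1.1)]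
-/

set_option autoImplicit false
set_option linter.dupNamespace false

noncomputable section

open scoped Classical
open PowerSeries WeierstrassCurve

namespace Summit.BirchSwinnertonDyer.BirchSwinnertonDyer.Theorems.ManinLocalTwoThree

variable {R : Type*} [CommRing R] (V : WeierstrassCurve R)

/-- **`z²x(z) ≡ 1 − a₄z⁴ − a₆z⁶ − a₄²z⁸ (mod z¹⁰)`** on a model with `a₁ = a₂ = a₃ = 0`, over any commutative ring: with
`u = z²x`, `v` the truncation and `F(t) = t² − t³ − a₄z⁴t − a₆z⁶`, one has `F(u) = 0` (chart equation), `F(v) = z¹⁰·Q` explicitly,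
and `F(u) − F(v) = (u − v)·G` with `G(0) = −1` a unit. [cite: SilvermanAEC2009, IV.1] -/
theorem formalXMulSq_sub_trunc_nine (h₁ : V.a₁ = 0) (h₂ : V.a₂ = 0) (h₃ : V.a₃ = 0) :
    ∃ E : R⟦X⟧, V.formalXMulSq - (1 - C V.a₄ * X ^ 4 - C V.a₆ * X ^ 6 - C (V.a₄ ^ 2) * X ^ 8) = X ^ 10 * E := by
  set u := V.formalXMulSq with hu
  set v : R⟦X⟧ := 1 - C V.a₄ * X ^ 4 - C V.a₆ * X ^ 6 - C (V.a₄ ^ 2) * X ^ 8 with hv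
  have hF : u ^ 2 - u ^ 3 - C V.a₄ * X ^ 4 * u - C V.a₆ * X ^ 6 = 0 := by
    have h := V.formalXMulSq_sq_eq
    rw [h₁, h₂, h₃] at h
    simp only [map_zero, zero_mul, add_zero] at h
    rw [← hu] at h
    linear_combination h
  set Q : R⟦X⟧ := -3 * C V.a₄ * C V.a₆ - (2 * C V.a₆ ^ 2 + 2 * C V.a₄ ^ 3) * X ^ 2 - C V.a₄ ^ 2 * C V.a₆ * X ^ 4 +
    (3 * C V.a₄ * C V.a₆ ^ 2 + C V.a₄ ^ 4) * X ^ 6 + (C V.a₆ ^ 3 + 6 * C V.a₄ ^ 3 * C V.a₆) * X ^ 8 +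
    (3 * C V.a₄ ^ 2 * C V.a₆ ^ 2 + 3 * C V.a₄ ^ 5) * X ^ 10 + 3 * C V.a₄ ^ 4 * C V.a₆ * X ^ 12 + C V.a₄ ^ 6 * X ^ 14 with hQ
  have hFv : v ^ 2 - v ^ 3 - C V.a₄ * X ^ 4 * v - C V.a₆ * X ^ 6 = X ^ 10 * Q := by
    rw [hv, hQ]; simp only [map_pow]; ring
  set G : R⟦X⟧ := u + v - (u ^ 2 + u * v + v ^ 2) - C V.a₄ * X ^ 4 with hG
  have key : (u - v) * G = -(X ^ 10 * Q) := by
    have e : (u - v) * G = (u ^ 2 - u ^ 3 - C V.a₄ * X ^ 4 * u - C V.a₆ * X ^ 6) -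
        (v ^ 2 - v ^ 3 - C V.a₄ * X ^ 4 * v - C V.a₆ * X ^ 6) := by rw [hG]; ring
    rw [e, hF, hFv, zero_sub]
  -- `G` is a unit: `G(0) = 1 + 1 − 3 − 0 = −1`
  have hu0 : constantCoeff u = 1 := V.constantCoeff_formalXMulSq
  have hv0 : constantCoeff v = 1 := by rw [hv]; simp
  have hG0 : constantCoeff G = -1 := by
    rw [hG]; simp only [map_sub, map_add, map_mul, map_pow, hu0, hv0, constantCoeff_C, constantCoeff_X]; ring
  have hGu : IsUnit G := by
    rw [PowerSeries.isUnit_iff_constantCoeff, hG0]; exact isUnit_one.neg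
  obtain ⟨g, hg⟩ := hGu
  refine ⟨-(Q * ↑g⁻¹), ?_⟩
  have : u - v = (u - v) * G * ↑g⁻¹ := by rw [← hg, mul_assoc, Units.mul_inv, mul_one]
  rw [this, key]; ring

/-- The coefficients of `z²x(z)` in degrees `< 10` are those of `1 − a₄z⁴ − a₆z⁶ − a₄²z⁸`. [cite: SilvermanAEC2009, IV.1] -/
theorem coeff_formalXMulSq_eq_coeff_trunc (h₁ : V.a₁ = 0) (h₂ : V.a₂ = 0) (h₃ : V.a₃ = 0) {n : ℕ} (hn : n < 10) :
    coeff n V.formalXMulSq = coeff n (1 - C V.a₄ * X ^ 4 - C V.a₆ * X ^ 6 - C (V.a₄ ^ 2) * X ^ 8 : R⟦X⟧) := by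
  obtain ⟨E, hE⟩ := formalXMulSq_sub_trunc_nine V h₁ h₂ h₃
  have h := congrArg (coeff n) hE
  rw [map_sub, coeff_X_pow_mul', if_neg (by omega)] at h
  exact sub_eq_zero.mp h

/-- `z²x(z)`: coefficient of `z⁴` is `−a₄`. [cite: SilvermanAEC2009, IV.1] -/
theorem coeff_formalXMulSq_four (h₁ : V.a₁ = 0) (h₂ : V.a₂ = 0) (h₃ : V.a₃ = 0) : coeff 4 V.formalXMulSq = -V.a₄ := by
  rw [coeff_formalXMulSq_eq_coeff_trunc V h₁ h₂ h₃ (by norm_num), map_sub, map_sub, map_sub,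
    coeff_C_mul_X_pow, coeff_C_mul_X_pow, coeff_C_mul_X_pow, coeff_one]
  norm_num

/-- `z²x(z)`: coefficient of `z⁵` is `0`. [cite: SilvermanAEC2009, IV.1] -/
theorem coeff_formalXMulSq_five (h₁ : V.a₁ = 0) (h₂ : V.a₂ = 0) (h₃ : V.a₃ = 0) : coeff 5 V.formalXMulSq = 0 := by
  rw [coeff_formalXMulSq_eq_coeff_trunc V h₁ h₂ h₃ (by norm_num), map_sub, map_sub, map_sub,
    coeff_C_mul_X_pow, coeff_C_mul_X_pow, coeff_C_mul_X_pow, coeff_one]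
  norm_num

/-- `z²x(z)`: coefficient of `z⁶` is `−a₆`. [cite: SilvermanAEC2009, IV.1] -/
theorem coeff_formalXMulSq_six (h₁ : V.a₁ = 0) (h₂ : V.a₂ = 0) (h₃ : V.a₃ = 0) : coeff 6 V.formalXMulSq = -V.a₆ := by
  rw [coeff_formalXMulSq_eq_coeff_trunc V h₁ h₂ h₃ (by norm_num), map_sub, map_sub, map_sub,
    coeff_C_mul_X_pow, coeff_C_mul_X_pow, coeff_C_mul_X_pow, coeff_one]
  norm_num

/-- `z²x(z)`: coefficient of `z⁷` is `0`. [cite: SilvermanAEC2009, IV.1] -/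
theorem coeff_formalXMulSq_seven (h₁ : V.a₁ = 0) (h₂ : V.a₂ = 0) (h₃ : V.a₃ = 0) : coeff 7 V.formalXMulSq = 0 := by
  rw [coeff_formalXMulSq_eq_coeff_trunc V h₁ h₂ h₃ (by norm_num), map_sub, map_sub, map_sub,
    coeff_C_mul_X_pow, coeff_C_mul_X_pow, coeff_C_mul_X_pow, coeff_one]
  norm_num

/-- `z²x(z)`: coefficient of `z⁸` is `−a₄²`. [cite: SilvermanAEC2009, IV.1] -/
theorem coeff_formalXMulSq_eight (h₁ : V.a₁ = 0) (h₂ : V.a₂ = 0) (h₃ : V.a₃ = 0) : coeff 8 V.formalXMulSq = -V.a₄ ^ 2 := by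
  rw [coeff_formalXMulSq_eq_coeff_trunc V h₁ h₂ h₃ (by norm_num), map_sub, map_sub, map_sub,
    coeff_C_mul_X_pow, coeff_C_mul_X_pow, coeff_C_mul_X_pow, coeff_one]
  norm_num

/-- `z²x(z)`: coefficient of `z⁹` is `0`. [cite: SilvermanAEC2009, IV.1] -/
theorem coeff_formalXMulSq_nine (h₁ : V.a₁ = 0) (h₂ : V.a₂ = 0) (h₃ : V.a₃ = 0) : coeff 9 V.formalXMulSq = 0 := by
  rw [coeff_formalXMulSq_eq_coeff_trunc V h₁ h₂ h₃ (by norm_num), map_sub, map_sub, map_sub,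
    coeff_C_mul_X_pow, coeff_C_mul_X_pow, coeff_C_mul_X_pow, coeff_one]
  norm_num

/-- **The tangent-line Kummer series to order `z⁹`.**  For `a₁ = a₂ = a₃ = 0` and any `x, y, α ∈ R`, the series
`Θ = z³y(z) − y z³ − α(z²x(z)·z − x z³)` (`z³y = −z²x`) has coefficients `a₄, α a₄, a₆, α a₆, a₄², α a₄²` in degrees `4 … 9`
(degrees `0 … 3`: `−1, −α, 0, αx − y`, the lead's `coeff_kummerCube_generic_le_three`). [cite: SilvermanAEC2009, IV.1] -/
theorem coeff_kummerCube_generic_four_to_nine (h₁ : V.a₁ = 0) (h₂ : V.a₂ = 0) (h₃ : V.a₃ = 0) (x y a : R) :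
    let Θ : R⟦X⟧ := V.formalYMulCube - C y * X ^ 3 - C a * (V.formalXMulSq * X - C x * X ^ 3)
    coeff 4 Θ = V.a₄ ∧ coeff 5 Θ = a * V.a₄ ∧ coeff 6 Θ = V.a₆ ∧ coeff 7 Θ = a * V.a₆ ∧ coeff 8 Θ = V.a₄ ^ 2 ∧
      coeff 9 Θ = a * V.a₄ ^ 2 := by
  intro Θ
  have hY : V.formalYMulCube = -V.formalXMulSq := rfl
  have x3 : coeff 3 V.formalXMulSq = 0 := by
    rw [coeff_formalXMulSq_eq_coeff_trunc V h₁ h₂ h₃ (by norm_num), map_sub, map_sub, map_sub,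
      coeff_C_mul_X_pow, coeff_C_mul_X_pow, coeff_C_mul_X_pow, coeff_one]
    norm_num
  have x4 := coeff_formalXMulSq_four V h₁ h₂ h₃
  have x5 := coeff_formalXMulSq_five V h₁ h₂ h₃
  have x6 := coeff_formalXMulSq_six V h₁ h₂ h₃
  have x7 := coeff_formalXMulSq_seven V h₁ h₂ h₃
  have x8 := coeff_formalXMulSq_eight V h₁ h₂ h₃
  have x9 := coeff_formalXMulSq_nine V h₁ h₂ h₃
  have hΘ : Θ = -V.formalXMulSq - C y * X ^ 3 - C a * X * V.formalXMulSq + C a * C x * X ^ 3 := by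
    show V.formalYMulCube - C y * X ^ 3 - C a * (V.formalXMulSq * X - C x * X ^ 3) = _
    rw [hY]; ring
  have hc : ∀ m, 3 ≤ m → coeff (m + 1) Θ = -coeff (m + 1) V.formalXMulSq - a * coeff m V.formalXMulSq := by
    intro m hm
    have hm3 : m + 1 ≠ 3 := by omega
    rw [hΘ]
    simp only [map_add, map_sub, map_neg, mul_assoc, coeff_C_mul, coeff_succ_X_mul, coeff_X_pow, hm3, if_false]
    ring
  refine ⟨?_, ?_, ?_, ?_, ?_, ?_⟩
  · rw [hc 3 le_rfl, x4, x3]; ring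
  · rw [hc 4 (by norm_num), x5, x4]; ring
  · rw [hc 5 (by norm_num), x6, x5]; ring
  · rw [hc 6 (by norm_num), x7, x6]; ring
  · rw [hc 7 (by norm_num), x8, x7]; ring
  · rw [hc 8 (by norm_num), x9, x8]; ring

end Summit.BirchSwinnertonDyer.BirchSwinnertonDyer.Theorems.ManinLocalTwoThree

end
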